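import Mathlib
import Summits.NavierStokesRegularity.NavierStokesRegularity.Theorems.ScaledTopAlignmentFlexibleZoomLU
import Summits.NavierStokesRegularity.NavierStokesRegularity.Theorems.ScaledTopAlignmentMostTimesEnd
import Summits.NavierStokesRegularity.NavierStokesRegularity.Theorems.LocalSineTubeDoorProfileAlignedWindowRigidity
import Summits.NavierStokesRegularity.NavierStokesRegularity.Theorems.ClockStretchingLawClockCeilingSingularStretchingNearZero
import Summits.NavierStokesRegularity.NavierStokesRegularity.Theorems.ScaledTopAlignmentDirectionGradientSelection
import Literature.Analysis.FluidPDE.VorticityCalculus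
import HarnessLib

/-!
# Route `ScaledTopAlignment`: Giga–Miura 2011, Cor. 2.6 LOCALISED TO THE RATE-NEAR-MAXIMUM REGION —
# a square-integrable-in-time sup bound on `∇ξ` over `{d < |ω(t,·)|, κ/(T−t) ≤ |ω(t,·)|}` (every
# `κ > 0`) excludes Type-I blow-up (support for the deciding crux W3ᵐᵗ = `AprioriMostTimesBulkAlignment`,
# stmt-NavierStokesRegularity-19551; no import of the route file)

Giga–Miura 2011, Cor. 2.6 (HUPS #956 p. 9; tree: `ScaledTopAlignmentGigaMiuraDirectionGradient`,
`hasSmoothExtensionPast_of_directionGradient_sqIntegrable_typeI`) asks `∫‖∇ζ(t)‖²_{L^∞(Ω_d(t))} dt < ∞`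
with the sup taken over the WHOLE top region `Ω_d(t) = {|ω| > d}`. The zoom proof only ever reads the
direction field at zoom preimages of points where the limit vorticity is bounded below — i.e. at
RATE-NEAR-MAXIMUM points `|ω(t,x)| ≥ κ/(T − t)` — so the hypothesis can be localised there: for every
`κ > 0` a measurable majorant `g_κ` of `t ↦ sup {‖∇ξ(t,x)‖ : d < |ω(t,x)|, κ/(T−t) ≤ |ω(t,x)|}` with
`∫_{(0,T)} g_κ² < ∞` suffices (`hasSmoothExtensionPast_of_directionGradient_sqIntegrable_nearMax_typeI`;
Cor. 2.6 is the special case `g_κ = g` for all `κ`). This is one step from print toward the route's door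
W3ᵐᵗ (stmt-19551), which is also read only at rate-near-maximum points `κ/(T−t) ≤ |ω(t,x)|`.

Proof (`false_of_directionGradient_sqIntegrable_nearMax_typeI`): as for Cor. 2.6 — flexible Type-I
zoom with locally uniform slice convergence (`typeIZoom_ancientMild_limit_flexible_locUnif`),
non-unidirectional end (`exists_end_curl_not_unidirectional`) — with one change of order: the uniform
vorticity FLOOR `m` of the limit on a compact slice interval `[a, b]` of that end
(`exists_curl_floor_Icc`) is taken FIRST and fixes `κ = m|b|/4`; then the a.e.-slice selection
(`exists_slice_frequently_lt_of_sqIntegrable`, Fatou on the tail of `∫ g_κ²`), the ball on which the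
zoomed vorticities exceed `m/2 ≥ …` — whose preimages are rate-near-maximum BECAUSE of the parabolic
law `T − t_j = λ_j²|s₀|/ν` — the mean-value inequality on the zoomed direction field, and
LocalSineTubeDoor's window rigidity `eq_zero_of_aligned_window`.
WHAT THIS IS NOT: not NS regularity — a Type-I-CONDITIONAL criterion (a localisation of a printed one);
it does not prove W3ᵐᵗ and leaves the residual NoTypeII (stmt-0056) untouched.

## References
* Y. Giga, H. Miura, Comm. Math. Phys. 303 (2011) 289–300 = HUPS #956: Cor. 2.6, Rmk. 2.7 (p. 9),
  Thm 1.1 / Rmk 1.4 (CA′) (pp. 3–4). [GigaMiura2011]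
* G. Koch, N. Nadirashvili, G. Seregin, V. Šverák, Acta Math. 203 (2009) 83–105: Prop. 4.1, Lemma 6.1,
  §6. [KochNadirashviliSereginSverak2009]
-/

noncomputable section

-- the summit and its single sub-problem share the name (CONVENTIONS §1), as in every Theorems file
set_option linter.dupNamespace false

open MeasureTheory Set Function Filter Topology Metric
open scoped RealInnerProductSpace ENNReal NNReal

namespace Summit.NavierStokesRegularity.NavierStokesRegularity.Theorems

open Literature.Analysis Literature.Analysis.FluidPDE
open Summit.NavierStokesRegularity.NavierStokesRegularity.Theorems.LocalSineTubeDoorProfileAlignedWindowRigidity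

/-! ### The blow-up form and the criterion -/

set_option maxHeartbeats 800000 in
/-- **A square-integrable-in-time sup bound on `∇ξ` over the rate-near-maximum top region kills
Type-I blow-up** (Giga–Miura 2011, Cor. 2.6, localised). Let `(u, p)` be a classical solution on
`ℝ³ × [0, T)`, Leray–Hopf from `u 0`, bounded on every `[0, T'] × ℝ³` (`T' < T`), with the Type-I rate
at `T` and no smooth extension past `T`; let `d > 0` and, for every `κ > 0`, a measurable
`g_κ : ℝ → [0,∞]` with `∫_{(0,T)} g_κ² < ∞` and `‖D(ξ(t))(x)‖ₑ ≤ g_κ t` whenever `t ∈ (0,T)`,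
`|ω(t,x)| > d` and `|ω(t,x)| ≥ κ/(T − t)`. Then `False`.
[cite: GigaMiura2011, Cor. 2.6 with Rmk. 2.7 (§2.1; HUPS preprint #956 p. 9)] -/
theorem false_of_directionGradient_sqIntegrable_nearMax_typeI {ν T : ℝ} (hν : 0 < ν) (hT : 0 < T)
    {u : ℝ → EuclideanSpace ℝ (Fin 3) → EuclideanSpace ℝ (Fin 3)}
    {p : ℝ → EuclideanSpace ℝ (Fin 3) → ℝ}
    (hsol : IsClassicalNSSolutionOn (Ico 0 T) ν 0 u p) (hLH : IsLerayHopfOn T ν 0 (u 0) u)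
    (hslab : ∀ T' < T, ∃ M : ℝ, ∀ t ∈ Icc 0 T', ∀ x, ‖u t x‖ ≤ M)
    (hI : IsTypeIBlowup u T) (hext : ¬ HasSmoothExtensionPast ν 0 u T)
    {d : ℝ} (hd : 0 < d)
    (hDξ : ∀ κ : ℝ, 0 < κ → ∃ g : ℝ → ℝ≥0∞, Measurable g ∧ (∫⁻ t in Ioo 0 T, g t ^ 2) < ∞ ∧
      ∀ t ∈ Ioo 0 T, ∀ x : EuclideanSpace ℝ (Fin 3), d < ‖curl (u t) x‖ →
        κ / (T - t) ≤ ‖curl (u t) x‖ → ‖fderiv ℝ (vorticityDirection (curl (u t))) x‖ₑ ≤ g t) :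
    False := by
  classical
  -- Step 1: the flexible zoom with locally uniform slice convergence, base times `τ_j = T - T/(j+2)`
  set τ : ℕ → ℝ := fun j => T - T / ((j : ℝ) + 2) with hτdef
  have hτ : ∀ j, τ j ∈ Ico 0 T := fun j => by
    have h2 : (0 : ℝ) < (j : ℝ) + 2 := by positivity
    have h3 : T / ((j : ℝ) + 2) ≤ T := by
      rw [div_le_iff₀ h2]; nlinarith [(Nat.cast_nonneg j : (0 : ℝ) ≤ j)]
    have h4 : 0 < T / ((j : ℝ) + 2) := div_pos hT h2
    simp only [hτdef, mem_Ico]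
    constructor <;> linarith
  have hτT : Tendsto τ atTop (𝓝 T) := by
    have h1 : Tendsto (fun j : ℕ => T / ((j : ℝ) + 2)) atTop (𝓝 0) := by
      have h := (tendsto_one_div_add_atTop_nhds_zero_nat (𝕜 := ℝ)).comp (tendsto_add_atTop_nat 1)
      have h' : Tendsto (fun j : ℕ => T * (1 / ((j : ℝ) + 2))) atTop (𝓝 (T * 0)) := by
        refine (h.congr fun j => ?_).const_mul T
        simp only [comp_apply, Nat.cast_add, Nat.cast_one]
        ring
      rw [mul_zero] at h'
      exact h'.congr fun j => by ring
    have h2 := h1.const_sub T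
    rw [sub_zero] at h2
    exact h2
  obtain ⟨φ, -, C, W, xc, lam, hWcl, hW0, hlam, -, hlam0, -, hflex, hLU⟩ :=
    typeIZoom_ancientMild_limit_flexible_locUnif hν hT hsol hLH hslab hI hext hτ hτT
  have hc : ∀ j, 0 < lam j ^ 2 / ν := fun j => div_pos (pow_pos (hlam j) 2) hν
  have hc0 : Tendsto (fun j => lam j ^ 2 / ν) atTop (𝓝 0) := by
    have h := (hlam0.pow 2).div_const ν
    rw [zero_pow two_ne_zero, zero_div] at h
    exact h
  -- Step 2: a non-unidirectional vorticity end `s < t₁` of `W`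
  obtain ⟨t₁, ht₁, hend⟩ := exists_end_curl_not_unidirectional hWcl ⟨-1, by norm_num, 0, hW0⟩
  have hnz : ∀ s < t₁, ∃ y, curl (W s) y ≠ 0 := by
    intro s hs
    by_contra h
    push Not at h
    have he1 : (EuclideanSpace.single (0 : Fin 3) (1 : ℝ) : EuclideanSpace ℝ (Fin 3)) ≠ 0 := by
      intro h0
      have := congr_arg (fun v : EuclideanSpace ℝ (Fin 3) => v 0) h0
      simp at this
    exact hend s hs ⟨EuclideanSpace.single 0 1, he1, fun y => ⟨0, by rw [h y, zero_smul]⟩⟩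
  -- Step 3: the slice interval `[a, b] = [2t₁ - 1, 2t₁]` of that end, its vorticity FLOOR `m`
  -- (`exists_curl_floor_Icc`), the rate threshold `κ = m|b|/4` and the majorant `g = g_κ`; then an
  -- a.e.-good slice `s₀ ∈ (a, b)` (`exists_slice_frequently_lt_of_sqIntegrable`)
  set b : ℝ := 2 * t₁ with hbdef
  have hb0 : b < 0 := by rw [hbdef]; linarith
  have hbt₁ : b < t₁ := by rw [hbdef]; linarith
  obtain ⟨m, hm, hfloor⟩ := exists_curl_floor_Icc hWcl (a := b - 1) hb0
    fun s hs => hnz s (lt_of_le_of_lt hs.2 hbt₁)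
  set κ : ℝ := m * (-b) / 4 with hκdef
  have hκ : 0 < κ := by rw [hκdef]; nlinarith
  obtain ⟨g, hgm, hg2, hDξκ⟩ := hDξ κ hκ
  obtain ⟨s₀, hs₀mem, hfreq⟩ := exists_slice_frequently_lt_of_sqIntegrable (T := T) hν hT hgm hg2 hlam
    hlam0 (show b - 1 < b by linarith) hb0
  have hs₀b : s₀ < b := hs₀mem.2
  have hs₀0 : s₀ < 0 := hs₀b.trans hb0
  set H : ℕ → ℝ≥0∞ := fun j => ENNReal.ofReal (lam j) * g (T + lam j ^ 2 / ν * s₀) with hHdef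
  -- Step 4: the slice `s₀`: a ball on which the limit vorticity stays above `3m/4`
  set Ω : EuclideanSpace ℝ (Fin 3) → EuclideanSpace ℝ (Fin 3) := curl (W s₀) with hΩdef
  obtain ⟨y₀, hy₀m⟩ := hfloor s₀ ⟨hs₀mem.1.le, hs₀mem.2.le⟩
  have hy₀ : Ω y₀ ≠ 0 := norm_pos_iff.1 (hm.trans hy₀m)
  have hΩc : Continuous Ω :=
    continuous_curl ((hWcl.contDiff_slice hs₀0).of_le (by exact_mod_cast le_top))
  set m₀ : ℝ := ‖Ω y₀‖ with hm₀def
  have hm₀ : 0 < m₀ := norm_pos_iff.2 hy₀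
  obtain ⟨r, hr, hball⟩ : ∃ r : ℝ, 0 < r ∧ ∀ y ∈ closedBall y₀ r, ‖Ω y - Ω y₀‖ < m₀ / 4 := by
    obtain ⟨δ, hδ, hδ'⟩ := Metric.continuousAt_iff.1 hΩc.continuousAt (m₀ / 4) (by positivity)
    refine ⟨δ / 2, by positivity, fun y hy => ?_⟩
    rw [← dist_eq_norm]
    exact hδ' (lt_of_le_of_lt (mem_closedBall.1 hy) (by linarith))
  have hΩne : ∀ y ∈ closedBall y₀ r, 3 * m₀ / 4 < ‖Ω y‖ := by
    intro y hy
    have h1 := hball y hy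
    have h2 : ‖Ω y₀‖ - ‖Ω y‖ ≤ ‖Ω y - Ω y₀‖ := by
      rw [← norm_neg (Ω y - Ω y₀), neg_sub]; exact norm_sub_norm_le _ _
    linarith
  have hΩne' : ∀ y ∈ closedBall y₀ r, Ω y ≠ 0 := fun y hy => by
    have := hΩne y hy
    exact norm_pos_iff.1 (by linarith)
  -- the vorticity zooms on the slice `s₀`, the physical times and the zoomed direction fields
  set F : ℕ → EuclideanSpace ℝ (Fin 3) → EuclideanSpace ℝ (Fin 3) := fun j y =>
    (lam j ^ 2 / ν) • curl (u (T + lam j ^ 2 * s₀ / ν)) (xc j + lam j • y) with hFdef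
  set tt : ℕ → ℝ := fun j => T + lam j ^ 2 * s₀ / ν with httdef
  have htt : ∀ j, T + lam j ^ 2 / ν * s₀ = tt j := fun j => by rw [httdef]; ring
  set ζ : ℕ → EuclideanSpace ℝ (Fin 3) → EuclideanSpace ℝ (Fin 3) := fun j y =>
    vorticityDirection (curl (u (tt j))) (xc j + lam j • y) with hζdef
  have hU : TendstoUniformlyOn F Ω atTop (closedBall y₀ r) :=
    (tendstoLocallyUniformly_iff_forall_isCompact.1 (hLU s₀ hs₀0)) _ (isCompact_closedBall _ _)
  have hev1 : ∀ᶠ j in atTop, ∀ y ∈ closedBall y₀ r, m₀ / 2 < ‖F j y‖ := by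
    filter_upwards [Metric.tendstoUniformlyOn_iff.1 hU (m₀ / 4) (by positivity)] with j hj y hy
    have h1 := hj y hy
    rw [dist_eq_norm] at h1
    have h2 := hΩne y hy
    have h3 : ‖Ω y‖ ≤ ‖Ω y - F j y‖ + ‖F j y‖ := by
      calc ‖Ω y‖ = ‖(Ω y - F j y) + F j y‖ := by rw [sub_add_cancel]
        _ ≤ ‖Ω y - F j y‖ + ‖F j y‖ := norm_add_le _ _
    linarith
  have hev2 : ∀ᶠ j in atTop, lam j ^ 2 / ν * d < m₀ / 2 := by
    have h1 : Tendsto (fun j => lam j ^ 2 / ν * d) atTop (𝓝 (0 * d)) := hc0.mul_const d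
    rw [zero_mul] at h1
    exact h1.eventually_lt_const (by positivity)
  have hev3 : ∀ᶠ j in atTop, tt j ∈ Ioo 0 T := by
    have h1 : Tendsto (fun j => lam j ^ 2 / ν * (-s₀)) atTop (𝓝 (0 * (-s₀))) := hc0.mul_const _
    rw [zero_mul] at h1
    filter_upwards [h1.eventually_lt_const hT] with j hj
    have h2 : lam j ^ 2 / ν * s₀ < 0 := mul_neg_of_pos_of_neg (hc j) hs₀0
    rw [← htt j]
    exact ⟨by linarith, by linarith⟩
  -- Step 5: on the good indices the zoomed direction field is `H j`-Lipschitz on the ball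
  have hgood : ∀ᶠ j in atTop, ∀ η : ℝ, H j < ENNReal.ofReal η →
      ∀ y ∈ closedBall y₀ r, ‖ζ j y - ζ j y₀‖ ≤ η * r := by
    filter_upwards [hev1, hev2, hev3] with j h1 h2 h3 η hH y hy
    -- `g (tt j)` is finite on a good index
    have hHj : H j = ENNReal.ofReal (lam j) * g (tt j) := by
      simp only [hHdef]; rw [htt j]
    have hlamj : ENNReal.ofReal (lam j) ≠ 0 := (ENNReal.ofReal_pos.2 (hlam j)).ne'
    have hgfin : g (tt j) ≠ ∞ := by
      intro htop
      rw [hHj, htop, ENNReal.mul_top hlamj] at hH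
      exact absurd hH (not_lt.2 le_top)
    have hη0 : (H j).toReal < η := ENNReal.toReal_lt_of_lt_ofReal hH
    have hHreal : (H j).toReal = lam j * (g (tt j)).toReal := by
      rw [hHj, ENNReal.toReal_mul, ENNReal.toReal_ofReal (hlam j).le]
    -- the ball's preimage lies in the top region `Ω_d(tt j)` and is RATE-NEAR-MAXIMUM
    have hnormF : ∀ z ∈ closedBall y₀ r,
        m₀ / 2 < lam j ^ 2 / ν * ‖curl (u (tt j)) (xc j + lam j • z)‖ := by
      intro z hz
      have hF := h1 z hz
      have e : ‖F j z‖ = lam j ^ 2 / ν * ‖curl (u (tt j)) (xc j + lam j • z)‖ := by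
        simp only [hFdef, httdef]
        rw [norm_smul, Real.norm_of_nonneg (hc j).le]
      rwa [e] at hF
    have htop : ∀ z ∈ closedBall y₀ r, d < ‖curl (u (tt j)) (xc j + lam j • z)‖ := fun z hz =>
      lt_of_mul_lt_mul_left (h2.trans (hnormF z hz)) (hc j).le
    have hTtt : T - tt j = lam j ^ 2 / ν * (-s₀) := by rw [httdef]; ring
    have hrate : ∀ z ∈ closedBall y₀ r, κ / (T - tt j) ≤ ‖curl (u (tt j)) (xc j + lam j • z)‖ := by
      intro z hz
      have hF := hnormF z hz
      have hpos : 0 < T - tt j := by rw [hTtt]; exact mul_pos (hc j) (neg_pos.2 hs₀0)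
      rw [div_le_iff₀ hpos, hTtt, hκdef]
      have hm₀m : m < m₀ := hy₀m
      have hsb : -b ≤ -s₀ := by linarith
      have h4 : m * (-b) ≤ m₀ * (-s₀) := by nlinarith
      nlinarith [mul_lt_mul_of_pos_right hF (neg_pos.2 hs₀0)]
    -- differentiability of the direction field there, with the derivative bound
    have hmem : tt j ∈ Ico 0 T := ⟨h3.1.le, h3.2⟩
    have hωdiff : Differentiable ℝ (curl (u (tt j))) :=
      (contDiff_curl (n := 1) ((hsol.contDiff_velocity hmem).of_le (by exact_mod_cast le_top))).differentiable
        (by simp)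
    have hξdiff : ∀ z ∈ closedBall y₀ r,
        DifferentiableAt ℝ (vorticityDirection (curl (u (tt j)))) (xc j + lam j • z) := fun z hz =>
      differentiableAt_vorticityDirection (hωdiff _) (norm_pos_iff.1 (hd.trans (htop z hz)))
    have hξbd : ∀ z ∈ closedBall y₀ r,
        ‖fderiv ℝ (vorticityDirection (curl (u (tt j)))) (xc j + lam j • z)‖ ≤ (g (tt j)).toReal := by
      intro z hz
      have h := ENNReal.toReal_mono hgfin (hDξκ (tt j) h3 _ (htop z hz) (hrate z hz))
      rwa [toReal_enorm] at h
    have hζder : ∀ z ∈ closedBall y₀ r, HasFDerivAt (ζ j)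
        ((fderiv ℝ (vorticityDirection (curl (u (tt j)))) (xc j + lam j • z)).comp
          (lam j • ContinuousLinearMap.id ℝ (EuclideanSpace ℝ (Fin 3)))) z := by
      intro z hz
      have haff : HasFDerivAt (fun y : EuclideanSpace ℝ (Fin 3) => xc j + lam j • y)
          (lam j • ContinuousLinearMap.id ℝ (EuclideanSpace ℝ (Fin 3))) z :=
        ((hasFDerivAt_id z).const_smul (lam j)).const_add (xc j)
      exact (hξdiff z hz).hasFDerivAt.comp z haff
    have hζbd : ∀ z ∈ closedBall y₀ r, ‖fderiv ℝ (ζ j) z‖ ≤ (g (tt j)).toReal * lam j := by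
      intro z hz
      rw [(hζder z hz).fderiv]
      refine (ContinuousLinearMap.opNorm_comp_le _ _).trans ?_
      refine mul_le_mul (hξbd z hz) ?_ (norm_nonneg _) ENNReal.toReal_nonneg
      rw [norm_smul, Real.norm_of_nonneg (hlam j).le]
      have := ContinuousLinearMap.norm_id_le (𝕜 := ℝ) (E := EuclideanSpace ℝ (Fin 3))
      nlinarith [(hlam j).le]
    -- mean value on the convex ball
    have hmv : ‖ζ j y - ζ j y₀‖ ≤ (g (tt j)).toReal * lam j * ‖y - y₀‖ :=
      (convex_closedBall y₀ r).norm_image_sub_le_of_norm_fderiv_le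
        (fun z hz => (hζder z hz).differentiableAt) hζbd (mem_closedBall_self hr.le) hy
    have hyr : ‖y - y₀‖ ≤ r := by rw [← dist_eq_norm]; exact mem_closedBall.1 hy
    have hC : (g (tt j)).toReal * lam j < η := by rw [mul_comm, ← hHreal]; exact hη0
    have hCnn : 0 ≤ (g (tt j)).toReal * lam j := mul_nonneg ENNReal.toReal_nonneg (hlam j).le
    calc ‖ζ j y - ζ j y₀‖ ≤ (g (tt j)).toReal * lam j * ‖y - y₀‖ := hmv
      _ ≤ (g (tt j)).toReal * lam j * r := mul_le_mul_of_nonneg_left hyr hCnn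
      _ ≤ η * r := mul_le_mul_of_nonneg_right hC.le hr.le
  -- the zoomed directions converge to the direction of the limit vorticity on the ball
  have hζlim : ∀ y ∈ closedBall y₀ r, Tendsto (fun j => ζ j y) atTop (𝓝 (‖Ω y‖⁻¹ • Ω y)) := by
    intro y hy
    have hconv : Tendsto (fun j => F j y) atTop (𝓝 (Ω y)) :=
      hflex s₀ hs₀0 (fun _ => s₀) tendsto_const_nhds y
    have hnd : ContinuousAt (fun v : EuclideanSpace ℝ (Fin 3) => ‖v‖⁻¹ • v) (Ω y) :=
      (continuous_norm.continuousAt.inv₀ (norm_ne_zero_iff.2 (hΩne' y hy))).smul continuousAt_id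
    refine (hnd.tendsto.comp hconv).congr fun j => ?_
    show ‖F j y‖⁻¹ • F j y = ζ j y
    simp only [hFdef, hζdef, httdef, vorticityDirection_apply]
    exact inv_norm_smul_smul_of_pos (hc j) _
  -- hence the limit directions agree on the ball
  have hpar : ∀ y ∈ closedBall y₀ r, ‖Ω y‖⁻¹ • Ω y = ‖Ω y₀‖⁻¹ • Ω y₀ := by
    intro y hy
    set D : ℝ := ‖‖Ω y‖⁻¹ • Ω y - ‖Ω y₀‖⁻¹ • Ω y₀‖ with hDdef
    have hDlim : Tendsto (fun j => ‖ζ j y - ζ j y₀‖) atTop (𝓝 D) :=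
      ((hζlim y hy).sub (hζlim y₀ (mem_closedBall_self hr.le))).norm
    have hDle : ∀ η : ℝ, 0 < η → D ≤ η * r := by
      intro η hη
      by_contra hlt
      push Not at hlt
      have hev : ∀ᶠ j in atTop, η * r < ‖ζ j y - ζ j y₀‖ := hDlim.eventually (lt_mem_nhds hlt)
      obtain ⟨j, hj1, hj2, hj3⟩ := ((hfreq η hη).and_eventually (hgood.and hev)).exists
      exact absurd (hj2 η hj1 y hy) (not_le.2 hj3)
    have hD0 : D ≤ 0 := by
      by_contra hpos
      push Not at hpos
      have h := hDle (D / (2 * r)) (by positivity)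
      have e : D / (2 * r) * r = D / 2 := by field_simp
      linarith
    have hD00 : D = 0 := le_antisymm hD0 (norm_nonneg _)
    exact sub_eq_zero.1 (norm_eq_zero.1 hD00)
  -- Step 6: `curl W(s₀)` is parallel to `Ω y₀` on the open ball — window rigidity kills `W`
  have hal : ∀ y ∈ ball y₀ r, cross (curl (W s₀) y) (Ω y₀) = 0 := by
    intro y hy
    have hy' : y ∈ closedBall y₀ r := ball_subset_closedBall hy
    have hΩy : Ω y ≠ 0 := hΩne' y hy'
    have e1 : Ω y = (‖Ω y‖ * ‖Ω y₀‖⁻¹) • Ω y₀ := by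
      calc Ω y = ‖Ω y‖ • (‖Ω y‖⁻¹ • Ω y) := by rw [smul_inv_smul₀ (norm_ne_zero_iff.2 hΩy)]
        _ = ‖Ω y‖ • (‖Ω y₀‖⁻¹ • Ω y₀) := by rw [hpar y hy']
        _ = (‖Ω y‖ * ‖Ω y₀‖⁻¹) • Ω y₀ := by rw [mul_smul]
    show cross (Ω y) (Ω y₀) = 0
    rw [e1]
    ext i
    fin_cases i <;> (simp [cross]; try ring)
  exact hW0 (eq_zero_of_aligned_window hWcl.hasTypeITimeDecay hWcl.continuousOn_uncurry
    (fun s t hst ht' x => hWcl.mild_eq_heatExtension hst ht' x) (fun t ht' => hWcl.isDivFree ht')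
    hs₀0 hy₀ isOpen_ball ⟨y₀, mem_ball_self hr⟩ hal (-1) (by norm_num) 0)

/-- **Giga–Miura 2011, Cor. 2.6, localised to the rate-near-maximum region — PROVED.** Let `ν > 0`,
`T > 0`, and let `(u, p)` be a classical unforced Navier–Stokes solution on `ℝ³ × [0, T)` which is
Leray–Hopf on `[0, T)` and bounded on `ℝ³ × [0, T']` for every `T' < T`, with a possible blow-up at `T`
of Type I (`IsTypeIBlowup u T`). If for some `d > 0` and EVERY `κ > 0` the function
`t ↦ sup {‖∇ξ(t,x)‖ : |ω(t,x)| > d, |ω(t,x)| ≥ κ/(T−t)}` (`ξ = ω/|ω|`) admits a measurable majorant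
`g_κ : ℝ → [0, ∞]` with `∫_{(0,T)} g_κ² < ∞`, then `u` continues as a classical solution past `T`.
Cor. 2.6 as printed (`hasSmoothExtensionPast_of_directionGradient_sqIntegrable_typeI`) is the case
`g_κ = g` for all `κ`. [cite: GigaMiura2011, Cor. 2.6 with Rmk. 2.7 (§2.1; HUPS preprint #956 p. 9)] -/
theorem hasSmoothExtensionPast_of_directionGradient_sqIntegrable_nearMax_typeI {ν T : ℝ} (hν : 0 < ν)
    (hT : 0 < T) {u : ℝ → EuclideanSpace ℝ (Fin 3) → EuclideanSpace ℝ (Fin 3)}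
    {p : ℝ → EuclideanSpace ℝ (Fin 3) → ℝ}
    (hsol : IsClassicalNSSolutionOn (Ico 0 T) ν 0 u p) (hLH : IsLerayHopfOn T ν 0 (u 0) u)
    (hbdd : ∀ T' < T, ∃ M : ℝ, ∀ t ∈ Icc 0 T', ∀ x, ‖u t x‖ ≤ M)
    (hI : IsTypeIBlowup u T)
    (hD : ∃ d : ℝ, 0 < d ∧ ∀ κ : ℝ, 0 < κ → ∃ g : ℝ → ℝ≥0∞, Measurable g ∧
      (∫⁻ t in Ioo 0 T, g t ^ 2) < ∞ ∧ ∀ t ∈ Ioo 0 T, ∀ x : EuclideanSpace ℝ (Fin 3),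
        d < ‖curl (u t) x‖ → κ / (T - t) ≤ ‖curl (u t) x‖ →
          ‖fderiv ℝ (vorticityDirection (curl (u t))) x‖ₑ ≤ g t) :
    HasSmoothExtensionPast ν 0 u T := by
  obtain ⟨d, hd, hDξ⟩ := hD
  by_contra hext
  exact false_of_directionGradient_sqIntegrable_nearMax_typeI hν hT hsol hLH hbdd hI hext hd hDξ

end Summit.NavierStokesRegularity.NavierStokesRegularity.Theorems

end
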